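import Literature.AnabelianGeometry.SemiGraphs.TemperedSpecialFibreInertia
import HarnessLib

/-!
# [SemiAnbd] Cor. 3.11, proof step (S2) «`p_α = p_β`»: the transport of `J_Σ`, of the level vertex
# groups and of the inertia groups along `γ : Δ[α] ⥲ Δ[β]`, PROVED; the reduction «(S2) ⇐ (S2a) ∧ (S2b)»

Mochizuki, *Semi-graphs of anabelioids*, Publ. RIMS **42** (2006), §3, Corollary 3.11, proof, manuscript
p. 46 l. 9–14 ("`I_Σ[□]` … may be recovered as the kernel `J_Σ[□]`"), p. 47 (i) ("applied to open subgroups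
of finite index … that correspond via `γ`"), p. 48 l. 9–24 ("normal open subgroups of finite index that
correspond via `γ` … the inertia group `I_v ⊆ D_v` … is necessarily of order a power of `p_□` … [since
there exist `Δ′[□]` for which `I_v` is nontrivial …] we obtain that `p_α = p_β`")
[cite: MochizukiSemiAnbd2006, Cor 3.11 pp.46-48].

PROOF-ONLY sequel of `TemperedSpecialFibreInertia.lean` (abc-iut cell, layer L3, sub-DAG
`plan/L3/SUBDAG-SemiAnbd-Cor311.md` row S2; seat abc-iut-L3-t11 gen 4, L3-lead α106).  No definition, no
instance.  For ANY isomorphism of topological groups `γ : Δ[α] ⥲ Δ[β]` and `Δ′ ⊴ Δ[α]`: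
`sigmaFiniteResidual_map_equiv` (`γ(J_Σ(Δ′)) = J_Σ(γ(Δ′))`: `J_Σ` is intrinsic, "may be recovered", p. 46),
`sigmaFiniteResidual_normal` (`J_Σ(Δ′) ⊴ Δ`), `mem_levelInertia_iff` (print's description of `I_v`),
`levelInertia_map_equiv` / `relIndex_levelInertia_map_equiv` (`γ(I_v) = I_{γ(v)}`, orders preserved — pure
group theory), `isLevelVertexGroup_map_equiv` (maximal compact subgroups of `Δ′/J_Σ` correspond: the
induced map of quotients is a homeomorphism), and **`residueCharOfTemperedIso_of_inertia`**: (S2)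
`ResidueCharOfTemperedIso pα pβ Ωα Ωβ` from (S2a) `InertiaOrdersPrimePow Σ p_□ Ω_□` on both sides and (S2b)
`HasNontrivialInertia Σ Ω_α` — `p_α^a = |I_v| = |I_{γ(v)}| = p_β^b` with `p_α^a ≠ 1`, hence `p_α = p_β`.
So row S2 reads «S2 ⇐ S2a ∧ S2b, transport PROVED» (discharged modulo the two geometric sentences of p. 48,
typed in the statements file and asserted for no origin).  Nothing here takes a side on [IUTchIII]
Cor. 3.12; typed ≠ proved for (S2a)/(S2b).
-/

noncomputable section

namespace Literature.AnabelianGeometry.SemiGraphs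

open Topology
open Literature.AnabelianGeometry.Anabelioids (IsSigmaInteger)

universe u v

/-! ### Coercion bookkeeping for isomorphisms of topological groups -/

section Coe

variable {Δ₁ : Type u} [Group Δ₁] [TopologicalSpace Δ₁] {Δ₂ : Type v} [Group Δ₂] [TopologicalSpace Δ₂]

/-- `γ⁻¹(γ(N)) = N` for subgroups. [folklore] -/
private theorem Subgroup.map_map_continuousMulEquiv_symm (e : Δ₁ ≃ₜ* Δ₂) (N : Subgroup Δ₁) :
    (N.map e.toMulEquiv.toMonoidHom).map e.symm.toMulEquiv.toMonoidHom = N := by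
  ext x
  refine ⟨?_, fun hx => ⟨e x, ⟨x, hx, rfl⟩, e.symm_apply_apply x⟩⟩
  rintro ⟨y, ⟨z, hz, rfl⟩, rfl⟩
  exact (congrArg (· ∈ N) (e.symm_apply_apply z)).mpr hz

end Coe

/-! ### Bookkeeping for `J_Σ(Δ′)` -/

section BookkeepingTop

variable {Δ : Type u} [Group Δ] [TopologicalSpace Δ]

/-- Membership in `J_Σ(Δ′)`. [cite: MochizukiSemiAnbd2006, Cor 3.11 p.46] -/
theorem mem_sigmaFiniteResidual_iff {S : Set ℕ} {N : Subgroup Δ} {x : Δ} :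
    x ∈ sigmaFiniteResidual S N ↔ x ∈ N ∧ ∀ W ∈ sigmaFiniteFamily S N, x ∈ W := by
  rw [sigmaFiniteResidual, Subgroup.mem_inf, Subgroup.mem_sInf]

end BookkeepingTop

/-! ### Transport of `J_Σ` along isomorphisms of topological groups ("correspond via `γ`", p. 48) -/

section Transport

variable {Δ₁ : Type u} [Group Δ₁] [TopologicalSpace Δ₁]
variable {Δ₂ : Type v} [Group Δ₂] [TopologicalSpace Δ₂]

/-- Pulling back a member of the `Σ`-family of `γ(Δ′)` along `γ` gives a member of the `Σ`-family of `Δ′`.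
[cite: MochizukiSemiAnbd2006, Cor 3.11 p.47] -/
theorem comap_mem_sigmaFiniteFamily (e : Δ₁ ≃ₜ* Δ₂) {S : Set ℕ} {N : Subgroup Δ₁} {W : Subgroup Δ₂}
    (hW : W ∈ sigmaFiniteFamily S (N.map e.toMulEquiv.toMonoidHom)) :
    W.comap e.toMulEquiv.toMonoidHom ∈ sigmaFiniteFamily S N := by
  obtain ⟨hWN, hWo, hWn, hWi⟩ := hW
  have hinj : Function.Injective e.toMulEquiv.toMonoidHom := e.toMulEquiv.injective
  have hmap : (W.comap e.toMulEquiv.toMonoidHom).map e.toMulEquiv.toMonoidHom = W :=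
    Subgroup.map_comap_eq_self (fun y _ => ⟨e.symm y, e.apply_symm_apply y⟩)
  refine ⟨fun x hx => ?_, ?_, fun n hn w hw => ?_, ?_⟩
  · have hx' : e.toMulEquiv.toMonoidHom x ∈ N.map e.toMulEquiv.toMonoidHom := hWN hx
    exact (Subgroup.mem_map_iff_mem hinj).mp hx'
  · exact hWo.preimage (map_continuous e)
  · change e.toMulEquiv.toMonoidHom (n * w * n⁻¹) ∈ W
    rw [map_mul, map_mul, map_inv]
    exact hWn _ (Subgroup.mem_map_of_mem _ hn) _ hw
  · rw [← Subgroup.relIndex_map_map_of_injective (f := e.toMulEquiv.toMonoidHom) _ N hinj, hmap]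
    exact hWi

/-- `γ(J_Σ(Δ′)) ⊆ J_Σ(γ(Δ′))`. [cite: MochizukiSemiAnbd2006, Cor 3.11 p.47] -/
theorem map_sigmaFiniteResidual_le (e : Δ₁ ≃ₜ* Δ₂) (S : Set ℕ) (N : Subgroup Δ₁) :
    (sigmaFiniteResidual S N).map e.toMulEquiv.toMonoidHom ≤
      sigmaFiniteResidual S (N.map e.toMulEquiv.toMonoidHom) := by
  rintro y ⟨x, hx, rfl⟩
  rw [SetLike.mem_coe, mem_sigmaFiniteResidual_iff] at hx
  rw [mem_sigmaFiniteResidual_iff]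
  refine ⟨Subgroup.mem_map_of_mem _ hx.1, fun W hW => ?_⟩
  exact hx.2 _ (comap_mem_sigmaFiniteFamily e hW)

end Transport

section Transport'

variable {Δ₁ : Type u} [Group Δ₁] [TopologicalSpace Δ₁]
variable {Δ₂ : Type v} [Group Δ₂] [TopologicalSpace Δ₂]

/-- **`J_Σ` corresponds via `γ`**: `γ(J_Σ(Δ′)) = J_Σ(γ(Δ′))` for every isomorphism of topological groups
`γ : Δ[α] ⥲ Δ[β]` — the kernel of `Δ′ → Δ̂′^Σ` is intrinsic (p. 46 "may be recovered as"; (i) p. 47).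
[cite: MochizukiSemiAnbd2006, Cor 3.11 pp.46-47] -/
theorem sigmaFiniteResidual_map_equiv (e : Δ₁ ≃ₜ* Δ₂) (S : Set ℕ) (N : Subgroup Δ₁) :
    (sigmaFiniteResidual S N).map e.toMulEquiv.toMonoidHom =
      sigmaFiniteResidual S (N.map e.toMulEquiv.toMonoidHom) := by
  refine le_antisymm (map_sigmaFiniteResidual_le e S N) ?_
  have h := map_sigmaFiniteResidual_le e.symm S (N.map e.toMulEquiv.toMonoidHom)
  rw [Subgroup.map_map_continuousMulEquiv_symm] at h
  intro y hy
  have hy' : e.symm y ∈ sigmaFiniteResidual S N := h ⟨y, hy, rfl⟩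
  exact ⟨e.symm y, hy', e.apply_symm_apply y⟩

end Transport'

/-! ### `J_Σ(Δ′)` is normal in `Δ` for `Δ′ ⊴ Δ` (transport along inner automorphisms) -/

section Normal

variable {Δ : Type u} [Group Δ] [TopologicalSpace Δ] [IsTopologicalGroup Δ]

omit [IsTopologicalGroup Δ] in
/-- A normal subgroup is carried to itself by an isomorphism acting as conjugation. [folklore] -/
private theorem Subgroup.map_eq_of_normal_of_conj (N : Subgroup Δ) [hN : N.Normal] (g : Δ) (e : Δ ≃ₜ* Δ)
    (he : ∀ x, e x = g * x * g⁻¹) : N.map e.toMulEquiv.toMonoidHom = N := by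
  ext x
  constructor
  · rintro ⟨y, hy, rfl⟩
    change e y ∈ N
    rw [he]
    exact hN.conj_mem y hy g
  · intro hx
    refine ⟨g⁻¹ * x * g⁻¹⁻¹, hN.conj_mem x hx g⁻¹, ?_⟩
    change e (g⁻¹ * x * g⁻¹⁻¹) = x
    rw [he]
    group

/-- **`J_Σ(Δ′) ⊴ Δ`** for a normal `Δ′ ⊴ Δ` (so that `Δ` acts on `Δ′/J_Σ` by conjugation — "the
decomposition group … acts naturally", p. 48 l. 11–12): transport of `J_Σ` along the inner automorphisms,
which are isomorphisms of the topological group `Δ`. [cite: MochizukiSemiAnbd2006, Cor 3.11 p.48] -/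
theorem sigmaFiniteResidual_normal (S : Set ℕ) (N : Subgroup Δ) [N.Normal] :
    (sigmaFiniteResidual S N).Normal := by
  refine ⟨fun x hx g => ?_⟩
  -- conjugation by `g` as an isomorphism of topological groups
  let e : Δ ≃ₜ* Δ :=
    { MulAut.conj g with
      continuous_toFun := show Continuous fun x => g * x * g⁻¹ from
        (continuous_const.mul continuous_id).mul continuous_const
      continuous_invFun := show Continuous fun x => g⁻¹ * x * g from
        (continuous_const.mul continuous_id).mul continuous_const }
  have he : ∀ x, e x = g * x * g⁻¹ := fun _ => rfl
  have h := sigmaFiniteResidual_map_equiv e S N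
  rw [Subgroup.map_eq_of_normal_of_conj N g e he] at h
  rw [← he, ← h]
  exact ⟨x, hx, rfl⟩

end Normal

/-! ### The inertia subgroup: membership, containment of `Δ′`, transport along `γ` -/

section Inertia

variable {Δ : Type u} [Group Δ]

/-- Membership in the centralising part `C` of `levelInertia`: `c` centralises `H` modulo `J`. [folklore] -/
private theorem mem_comap_centralizer_iff (J : Subgroup Δ) [J.Normal] (H : Subgroup Δ) (c : Δ) :
    c ∈ (Subgroup.centralizer ((QuotientGroup.mk' J) '' (H : Set Δ))).comap (QuotientGroup.mk' J) ↔
      ∀ h ∈ H, (h * c)⁻¹ * (c * h) ∈ J := by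
  rw [Subgroup.mem_comap, Subgroup.mem_centralizer_iff]
  constructor
  · intro hc h hh
    have h1 := hc _ ⟨h, hh, rfl⟩
    rw [← map_mul, ← map_mul, QuotientGroup.mk'_apply, QuotientGroup.mk'_apply, QuotientGroup.eq] at h1
    exact h1
  · rintro hc _ ⟨h, hh, rfl⟩
    rw [← map_mul, ← map_mul, QuotientGroup.mk'_apply, QuotientGroup.mk'_apply, QuotientGroup.eq]
    exact hc h hh

/-- "`I_v ⊆ D_v ⊆ Δ[□]/Δ′[□]`": the inertia subgroup contains `Δ′` (so that `I_v` is its image in the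
finite group `Δ[□]/Δ′[□]`). [cite: MochizukiSemiAnbd2006, Cor 3.11 p.48] -/
theorem le_levelInertia (N J : Subgroup Δ) [J.Normal] (H : Subgroup Δ) : N ≤ levelInertia N J H :=
  le_sup_left

/-- **Membership in `I_v`, print's form** ("the subgroup that acts trivially on this anabelioid",
p. 48 l. 13–14): for `Δ′ ⊴ Δ`, `d ∈ levelInertia Δ′ J H` iff the conjugation action of `d` on `H`, read
modulo `J`, COINCIDES with conjugation by some `π ∈ Δ′` — i.e. `d` lies over the decomposition group `D_v`
(it stabilises the `Δ′`-class of `H/J`) and induces the trivial outer automorphism of `H/J` (= the kernel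
of `D_v → Out(H/J)`, granted `H/J` self-normalising in `Δ′/J` — Thm 3.7 (ii) p. 40 "verticial subgroups
that arise from distinct parametrization data are distinct", under the (S1) identification).
[cite: MochizukiSemiAnbd2006, Cor 3.11 p.48] -/
theorem mem_levelInertia_iff {N J : Subgroup Δ} [hN : N.Normal] [hJ : J.Normal] {H : Subgroup Δ} {d : Δ} :
    d ∈ levelInertia N J H ↔ ∃ π ∈ N, ∀ h ∈ H, (π * h * π⁻¹)⁻¹ * (d * h * d⁻¹) ∈ J := by
  rw [levelInertia, ← SetLike.mem_coe, Subgroup.normal_mul, Set.mem_mul]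
  constructor
  · rintro ⟨π, hπ, c, hc, rfl⟩
    rw [SetLike.mem_coe, mem_comap_centralizer_iff] at hc
    refine ⟨π, hπ, fun h hh => ?_⟩
    -- `(πhπ⁻¹)⁻¹ (πc) h (πc)⁻¹ = π c · ((h c)⁻¹ (c h)) · c⁻¹ π⁻¹`
    have := hJ.conj_mem _ (hc h hh) (π * c)
    convert this using 1
    group
  · rintro ⟨π, hπ, hd⟩
    refine ⟨π, hπ, π⁻¹ * d, ?_, by group⟩
    rw [SetLike.mem_coe, mem_comap_centralizer_iff]
    intro h hh
    have := hJ.conj_mem _ (hd h hh) d⁻¹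
    convert this using 1
    group

/-- The inertia subgroup `I_v` depends on `J` only through the subgroup `J` (not through its normality
witness) — bookkeeping for rewriting `J_Σ` along "correspond via `γ`". [cite: MochizukiSemiAnbd2006, Cor 3.11 p.48] -/
theorem levelInertia_congr_right {N J J' : Subgroup Δ} (hJ : J.Normal) (hJ' : J'.Normal) (H : Subgroup Δ)
    (h : J = J') : levelInertia (hJ := hJ) N J H = levelInertia (hJ := hJ') N J' H := by
  subst h; rfl

end Inertia

section InertiaTransport

variable {Δ₁ : Type u} [Group Δ₁] {Δ₂ : Type v} [Group Δ₂]

/-- The centralising part of `levelInertia` is carried along a group isomorphism. [folklore] -/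
private theorem map_comap_centralizer_equiv (e : Δ₁ ≃* Δ₂) (J H : Subgroup Δ₁) [hJ : J.Normal]
    [hJ' : (J.map e.toMonoidHom).Normal] :
    ((Subgroup.centralizer ((QuotientGroup.mk' J) '' (H : Set Δ₁))).comap (QuotientGroup.mk' J)).map
        e.toMonoidHom =
      (Subgroup.centralizer ((QuotientGroup.mk' (J.map e.toMonoidHom)) ''
        ((H.map e.toMonoidHom : Subgroup Δ₂) : Set Δ₂))).comap (QuotientGroup.mk' (J.map e.toMonoidHom)) := by
  ext y
  rw [Subgroup.mem_map_equiv, mem_comap_centralizer_iff, mem_comap_centralizer_iff]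
  constructor
  · intro hc
    rintro _ ⟨h, hh, rfl⟩
    have := Subgroup.mem_map_of_mem e.toMonoidHom (hc h hh)
    simpa [map_mul, map_inv, MulEquiv.apply_symm_apply] using this
  · intro hc h hh
    have h2 := hc (e h) (Subgroup.mem_map_of_mem _ hh)
    rw [Subgroup.mem_map_equiv] at h2
    simpa [map_mul, map_inv] using h2

/-- **`I_v` corresponds via `γ`**: `γ(levelInertia Δ′ J H) = levelInertia γ(Δ′) γ(J) γ(H)` for every
group isomorphism `γ` ("normal open subgroups of finite index that correspond via `γ`", p. 48 l. 9–10).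
[cite: MochizukiSemiAnbd2006, Cor 3.11 p.48] -/
theorem levelInertia_map_equiv (e : Δ₁ ≃* Δ₂) (N J H : Subgroup Δ₁) [hJ : J.Normal]
    [hJ' : (J.map e.toMonoidHom).Normal] :
    (levelInertia N J H).map e.toMonoidHom =
      levelInertia (N.map e.toMonoidHom) (J.map e.toMonoidHom) (H.map e.toMonoidHom) := by
  rw [levelInertia, levelInertia, Subgroup.map_sup, map_comap_centralizer_equiv]

/-- **The order of `I_v` is preserved by `γ`**: `[levelInertia : Δ′] = [γ(levelInertia) : γ(Δ′)]`.
[cite: MochizukiSemiAnbd2006, Cor 3.11 p.48] -/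
theorem relIndex_levelInertia_map_equiv (e : Δ₁ ≃* Δ₂) (N J H : Subgroup Δ₁) [hJ : J.Normal]
    [hJ' : (J.map e.toMonoidHom).Normal] :
    (N.map e.toMonoidHom).relIndex
        (levelInertia (N.map e.toMonoidHom) (J.map e.toMonoidHom) (H.map e.toMonoidHom)) =
      N.relIndex (levelInertia N J H) := by
  rw [← levelInertia_map_equiv e N J H, Subgroup.relIndex_map_map_of_injective _ _ e.injective]

end InertiaTransport

section VertexTransport

variable {Δ₁ : Type u} [Group Δ₁] [TopologicalSpace Δ₁]
variable {Δ₂ : Type v} [Group Δ₂] [TopologicalSpace Δ₂]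

/-- Compact images in `Δ[α]/J` are carried to compact images in `Δ[β]/γ(J)` by an isomorphism of
topological groups `γ` (the induced bijection of quotients is continuous). [folklore] -/
private theorem isCompact_image_mk_map_equiv (e : Δ₁ ≃ₜ* Δ₂) (J : Subgroup Δ₁) [J.Normal] (J₂ : Subgroup Δ₂)
    [J₂.Normal] (hJ₂ : J.map e.toMulEquiv.toMonoidHom = J₂) (X : Set Δ₁)
    (hX : IsCompact ((QuotientGroup.mk : Δ₁ → Δ₁ ⧸ J) '' X)) :
    IsCompact ((QuotientGroup.mk : Δ₂ → Δ₂ ⧸ J₂) '' (e '' X)) := by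
  have hle : J ≤ J₂.comap e.toMulEquiv.toMonoidHom := fun x hx =>
    Subgroup.mem_comap.mpr (hJ₂ ▸ Subgroup.mem_map_of_mem _ hx)
  let ē : Δ₁ ⧸ J →* Δ₂ ⧸ J₂ := QuotientGroup.map J J₂ e.toMulEquiv.toMonoidHom hle
  have hcomp : (fun x : Δ₁ => ē (QuotientGroup.mk x)) = fun x => QuotientGroup.mk (e x) :=
    funext fun x => QuotientGroup.map_mk J J₂ e.toMulEquiv.toMonoidHom hle x
  have hcont : Continuous ē := by
    rw [(QuotientGroup.isQuotientMap_mk J).continuous_iff]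
    change Continuous fun x => ē (QuotientGroup.mk x)
    exact hcomp ▸ QuotientGroup.continuous_mk.comp (map_continuous e)
  rw [Set.image_image, ← Set.image_congr' fun x => congrFun hcomp x, ← Set.image_image]
  exact hX.image hcont

/-- The image of a subgroup under `γ`, as a set. [folklore] -/
private theorem coe_map_toMulEquiv_toMonoidHom_eq_image (e : Δ₁ ≃ₜ* Δ₂) (H : Subgroup Δ₁) :
    ((H.map e.toMulEquiv.toMonoidHom : Subgroup Δ₂) : Set Δ₂) = e '' (H : Set Δ₁) :=
  Set.ext fun _ => ⟨fun ⟨x, hx, h⟩ => ⟨x, hx, h⟩, fun ⟨x, hx, h⟩ => ⟨x, hx, h⟩⟩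

/-- One half of **the level vertex groups correspond via `γ`**: the image under `γ` of a subgroup between
`J_Σ(Δ′)` and `Δ′` with compact image in `Δ/J_Σ` is such a subgroup for `γ(Δ′)`.
[cite: MochizukiSemiAnbd2006, Cor 3.11 p.47] -/
theorem isCompact_image_mk_sigmaFiniteResidual_map_equiv [IsTopologicalGroup Δ₁] [IsTopologicalGroup Δ₂]
    (e : Δ₁ ≃ₜ* Δ₂) (S : Set ℕ) (N : Subgroup Δ₁) [N.Normal] (H : Subgroup Δ₁)
    (hHc : IsCompact ((QuotientGroup.mk : Δ₁ → Δ₁ ⧸ sigmaFiniteResidual S N) '' (H : Set Δ₁))) :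
    IsCompact ((QuotientGroup.mk : Δ₂ → Δ₂ ⧸ sigmaFiniteResidual S (N.map e.toMulEquiv.toMonoidHom)) ''
      ((H.map e.toMulEquiv.toMonoidHom : Subgroup Δ₂) : Set Δ₂)) := by
  haveI : (sigmaFiniteResidual S N).Normal := sigmaFiniteResidual_normal S N
  haveI : (N.map e.toMulEquiv.toMonoidHom).Normal := Subgroup.Normal.map inferInstance _ e.surjective
  haveI : (sigmaFiniteResidual S (N.map e.toMulEquiv.toMonoidHom)).Normal :=
    sigmaFiniteResidual_normal S _
  rw [coe_map_toMulEquiv_toMonoidHom_eq_image]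
  exact isCompact_image_mk_map_equiv e (sigmaFiniteResidual S N) _ (sigmaFiniteResidual_map_equiv e S N)
    _ hHc

/-- **The level vertex groups correspond via `γ`** (p. 47 (i): "the technique … may also be applied to
open subgroups of finite index … that correspond via `γ`"; for the intrinsic notion this is a theorem:
`γ` induces `Δ′[α]/J_Σ ≅ Δ′[β]/J_Σ` as topological groups, which carries maximal compact subgroups to
maximal compact subgroups). [cite: MochizukiSemiAnbd2006, Cor 3.11 p.47] -/
theorem isLevelVertexGroup_map_equiv [IsTopologicalGroup Δ₁] [IsTopologicalGroup Δ₂] (e : Δ₁ ≃ₜ* Δ₂)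
    {S : Set ℕ} {N H : Subgroup Δ₁} [N.Normal] (hH : IsLevelVertexGroup S N H) :
    IsLevelVertexGroup S (N.map e.toMulEquiv.toMonoidHom) (H.map e.toMulEquiv.toMonoidHom) := by
  obtain ⟨hJH, hHN, hHc, hmax⟩ := hH
  have hJeq := sigmaFiniteResidual_map_equiv e S N
  haveI hN₂ : (N.map e.toMulEquiv.toMonoidHom).Normal := Subgroup.Normal.map inferInstance _ e.surjective
  refine ⟨?_, Subgroup.map_mono hHN, isCompact_image_mk_sigmaFiniteResidual_map_equiv e S N H hHc,
    fun H' hJH' hH'N hH'c hHH' => ?_⟩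
  · rw [← hJeq]; exact Subgroup.map_mono hJH
  · -- maximality: pull `H'` back along `γ`, apply `hmax`, push forward again
    have hb := Subgroup.map_map_continuousMulEquiv_symm e
    have hc₁ := isCompact_image_mk_sigmaFiniteResidual_map_equiv e.symm S _ H' hH'c
    rw [hb N] at hc₁
    have hJ₁ := Subgroup.map_mono (f := e.symm.toMulEquiv.toMonoidHom) hJH'
    rw [← hJeq, hb] at hJ₁
    have hN₁ := Subgroup.map_mono (f := e.symm.toMulEquiv.toMonoidHom) hH'N
    have hHH₁ := Subgroup.map_mono (f := e.symm.toMulEquiv.toMonoidHom) hHH'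
    rw [hb] at hN₁ hHH₁
    have h2 := Subgroup.map_map_continuousMulEquiv_symm e.symm H'
    rw [ContinuousMulEquiv.symm_symm, hmax _ hJ₁ hN₁ hc₁ hHH₁] at h2
    exact h2.symm

end VertexTransport

/-! ### (S2) from (S2a) ∧ (S2b): "we obtain that `p_α = p_β`" -/

section Reduction

variable {Kα : Type u} [Field Kα] {Kβ : Type u} [Field Kβ]

/-- Arithmetic of the last sentence: if `p^a = q^b` for primes `p, q` with `p^a ≠ 1`, then `p = q`.
[folklore] -/
private theorem prime_eq_of_pow_eq_pow {p q a b : ℕ} (hp : p.Prime) (hq : q.Prime) (h : p ^ a = q ^ b)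
    (h1 : p ^ a ≠ 1) : p = q := by
  have ha : a ≠ 0 := by rintro rfl; exact h1 (pow_zero p)
  exact (Nat.prime_dvd_prime_iff_eq hp hq).mp (hp.dvd_of_dvd_pow (h ▸ dvd_pow_self p ha))

/-- **[SemiAnbd] Cor. 3.11, step (S2) from the two geometric sentences of its printed proof**
(p. 48 l. 9–24): for `γ : Δ[α] ⥲ Δ[β]`, a normal open subgroup of finite index `Δ′[α]` with a level vertex
group `H` of NONTRIVIAL inertia (S2b) corresponds via `γ` to `Δ′[β] := γ(Δ′[α])` with the level vertex
group `γ(H)` (`isLevelVertexGroup_map_equiv`), and `γ` carries `I_v` to `I_{γ(v)}` preserving its order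
(`relIndex_levelInertia_map_equiv`, `sigmaFiniteResidual_map_equiv`); by (S2a) on both sides that common
order is `p_α^a = p_β^b` with `p_α^a ≠ 1`, hence `p_α = p_β`.  The residual inputs are exactly (S2a) at
`Ω_α` and `Ω_β` and (S2b) at `Ω_α`, at one set of primes `Σ` (print: `p_α, p_β ∉ Σ`).
[cite: MochizukiSemiAnbd2006, Cor 3.11 p.48] -/
theorem residueCharOfTemperedIso_of_inertia (pα pβ : ℕ) [Fact pα.Prime] [Fact pβ.Prime]
    [Algebra ℚ_[pα] Kα] [FiniteDimensional ℚ_[pα] Kα] [Algebra ℚ_[pβ] Kβ] [FiniteDimensional ℚ_[pβ] Kβ]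
    (Ωα : SpecialFibreOrigin Kα) (Ωβ : SpecialFibreOrigin Kβ) (S : Set ℕ)
    (hα : InertiaOrdersPrimePow S pα Ωα) (hβ : InertiaOrdersPrimePow S pβ Ωβ)
    (hne : HasNontrivialInertia S Ωα) : ResidueCharOfTemperedIso pα pβ Ωα Ωβ := by
  rintro Dα Dβ Sα Sβ hSα hSβ ⟨γ⟩
  -- (S2b) at `α`: a level `Δ′`, a vertex group `H` with `I_v ≠ 1`; (S2a) at `α`: `|I_v| = p_α^a`
  obtain ⟨N, hJ, hN, hNo, hNf, H, hH, hI⟩ := hne Dα Sα hSα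
  obtain ⟨a, ha⟩ := hα Dα Sα hSα N hJ hN hNo hNf H hH
  -- transport to `β` along `γ`
  haveI := hN
  have hN₂ : (N.map γ.toMulEquiv.toMonoidHom).Normal := Subgroup.Normal.map hN _ γ.surjective
  have hNo₂ : IsOpen ((N.map γ.toMulEquiv.toMonoidHom : Subgroup Dβ.delta) : Set Dβ.delta) := by
    rw [coe_map_toMulEquiv_toMonoidHom_eq_image]
    exact (γ : Dα.delta ≃ₜ Dβ.delta).isOpenMap _ hNo
  have hNf₂ : (N.map γ.toMulEquiv.toMonoidHom).FiniteIndex :=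
    ⟨by rw [Subgroup.index_map_of_bijective (f := γ.toMulEquiv.toMonoidHom) γ.bijective]
        exact hNf.index_ne_zero⟩
  have hH₂ := isLevelVertexGroup_map_equiv γ hH
  obtain ⟨b, hb⟩ := hβ Dβ Sβ hSβ _ (sigmaFiniteResidual_normal S _) hN₂ hNo₂ hNf₂ _ hH₂
  -- the orders agree
  haveI hJ₂ : ((sigmaFiniteResidual S N).map γ.toMulEquiv.toMonoidHom).Normal := by
    rw [sigmaFiniteResidual_map_equiv]; exact sigmaFiniteResidual_normal S _
  haveI := hJ
  have htrans := relIndex_levelInertia_map_equiv γ.toMulEquiv N (sigmaFiniteResidual S N) H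
  have hb' : N.relIndex (levelInertia (hJ := hJ) N (sigmaFiniteResidual S N) H) = pβ ^ b := by
    rw [← htrans, levelInertia_congr_right hJ₂ (sigmaFiniteResidual_normal S _) _
      (sigmaFiniteResidual_map_equiv γ S N)]
    exact hb
  rw [ha] at hb' hI
  exact prime_eq_of_pow_eq_pow (Fact.out : pα.Prime) (Fact.out : pβ.Prime) hb' hI

end Reduction

end Literature.AnabelianGeometry.SemiGraphs

end
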